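import Summits.Ventures.QEC.CircuitDistance.PortK2DataBB144X
import Summits.Ventures.QEC.CircuitDistance.K2Chunks
import HarnessLib

/-!
# K2(`[[144,12,12]]`) chunk module `K2C144X1c0` — COMPUTATIONAL (native_decide; `Lean.ofReduceBool`)

Cell `qec`, CDX, R146 STEP 1 («computational» header; `ofReduceBool` confined to these chunk modules). Checker of record
`K2.K2Data` (qec-cdx-type-1, PortK2Check); data module of record `PortK2DataBB144X/Z` (p669158/9, crit-1 data audit PASS
2026-08-28T21:20Z); chunk glue `K2Chunks` (idea-1 g2). cube 1, child 0 (depth-1 leaf)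
Leaf theorems: the K2 DFS accepts below one child / grandchild state of a pivot cube; assemblies re-derive the child lists in the
kernel (`decide`) and end in the literal cube fact `d144S.cube (Ts144S.getD k []) (72*k) (lives144S.getD k 0) = true` (the `hcubes`
hypothesis of `K2Inst.k2_complete`). Emitted by qec-cdx-eng-1 with idea-1's `gen_k2chunks_from_lean.py`.
-/

namespace Summit.Ventures.QEC.CircuitDistance.K2

set_option maxRecDepth 100000 in
set_option maxHeartbeats 0 in
set_option exponentiation.threshold 1024 in
/-- K2(144) chunk fact `cube144X1_ch0` (see the module docstring). -/
theorem cube144X1_ch0 : app5 (d144X.dfs (Ts144X.getD 1 []) 7) (8650757, 1984, 155838093934698292051968, 2, 2348542582773833227889480596789337027375682548908319870707290971532209025114608443463538437924351135094669312) = true := by native_decide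

end Summit.Ventures.QEC.CircuitDistance.K2
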